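import Summits.QuantumFields.BalabanUV.T4Continuum.Support.TermwiseResidualWitness

/-!
# Spine/NE7/QLa — the ONE-RUN item «(QL-a)» of spine estimate NE7 as ONE named shape, and the two bookkeeping facts that
# place it: two one-run copies give the two-run binder `hsize` of route 1's END literally, and it is the only binder of the
# t-bracket that is not data ∕ geometry ∕ another row's rate

Cell `pub-balaban-gaps` (YM blitz Y1, track G2, seat `ne7`); text of record `run/shared/lean/pub/pub-balaban-gaps/ne/NE7.md`
§4 ∕ §7, where NE7 (node U5 «matching modulo constants», `T4MatchingAssembly.HybridNE7`) is classified IDEA-bound at exactly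
one named item and WORK-bound around it.  That item is the b2b cell's «(QL-a)» (road P4 ∕ road P1's (W-size) at `U = 1`;
`t4/ideate/NE7-WALL.md` v16 §1: «the scale-resolved effective-observable type of ONE inserted local functional, read uniformly
in the unit field — which is exactly the analysis [Balaban1989LargeFieldII] p. 356 defers»).  In the kernel it is, letter for
letter, the binder `hsize` of `TermwiseResidualWitness.tBracket_le` ∕ `witness_centring_le` (the t-bracket of route 1's END
`TermwiseLocal.goodClause_summable_UN_levels_of_thm1At_residualW`): the `t`-discrepancies of the FIELD-INDEPENDENT step
constants `c(t,X) − c(0,X)` of a dressed run, summed over the localization domains `X` of scale `j`, are at most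
`vol·Ew·a^{K−j}` — a GEOMETRIC slice profile in the age `K − j`, with `a < 1` load-bearing (with `a = 1` the END's remainder is
not summable: `T4BookingNecessity`).  This file gives that shape ONE name per run (`QLa`), records that the two-run binder is
the sum of two one-run copies (`hsize_of_qla` — so the item is ONE-run, as the census says), and monotonicity in the constants.

HONEST FRAMING.  (QL-a) is NOT IN PRINT for a non-abelian d = 4 model: the printed (0.30) of [Balaban1987RG1] p. 258,
`|𝐄_k| ≤ Σ_j Σ_{X∈𝐃_j} O(1)(L^jη)^{4+α} exp(−κ d_j(X))`, is the UNDRESSED statement of this TYPE (its factor `(L^jη)^α` is a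
geometric slice profile); the dressed one is deferred in print ([Balaban1989LargeFieldII] p. 356); the nearest gauge-model
print, [BalabanImbrieJaffe1988] pp. 271, 276, 311–312 (abelian Higgs, d ≤ 3), carries observables as separate factors
«bounded independently of ε», no decay.  Nothing printed is used as a hypothesis here; `QLa` is a PARAMETRIC SHAPE (a
definition of a proposition), NOT a fact; every theorem is [folklore] bookkeeping over finite sums; 0 sorry.  NE7 NOT proved;
spine 0∕9; fixed finite T⁴ — NOT ℝ⁴, NOT a mass gap, NOT Clay.  This file changes no census value.
-/

noncomputable section

open Finset
open scoped BigOperators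

namespace Summit.QuantumFields.BalabanUV.T4Continuum.Spine.NE7

variable {D : Type*}

/-- [shape] **(QL-a) FOR ONE RUN.**  A ledger `wf` of localization domains with scales `sc`, the run's field-independent step
constants at source strength `t` (`ct`) and at `0` (`c0`), the number of steps `K`, the volume factor `vol`, a size constant `Ew`
and a ratio `a`: the scale-`j` slice of the `t`-discrepancy is at most `vol·Ew·a^{K−j}` for every `j ≤ K`.  The load-bearing
letter is `a < 1` (not part of the shape; displayed by the consumer).  A definition of a proposition — NOT a fact; NOT IN
PRINT for Bałaban's d = 4 procedure. [folklore] -/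
def QLa (wf : Finset D) (sc : D → ℕ) (ct c0 : D → ℝ) (K : ℕ) (vol Ew a : ℝ) : Prop :=
  ∀ j ≤ K, ∑ X ∈ wf with sc X = j, |ct X - c0 X| ≤ vol * (Ew * a ^ (K - j))

/-- [bookkeeping] **TWO ONE-RUN COPIES GIVE THE TWO-RUN BINDER, LITERALLY.**  `QLa` for run A with `EwA` and for run B with
`EwB` on the same ledger give the binder `hsize` of `TermwiseResidualWitness.tBracket_le` ∕ `witness_centring_le` with
`Ew = EwA + EwB` — so (QL-a) is a ONE-run statement; the two-run content of the t-bracket sits in its RATE binder (row NE5's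
ask), not here. [folklore] -/
theorem hsize_of_qla {wf : Finset D} {sc : D → ℕ} {cAt cA0 cBt cB0 : D → ℝ} {K : ℕ} {vol EwA EwB a : ℝ}
    (hA : QLa wf sc cAt cA0 K vol EwA a) (hB : QLa wf sc cBt cB0 K vol EwB a) :
    ∀ j ≤ K, ∑ X ∈ wf with sc X = j, (|cAt X - cA0 X| + |cBt X - cB0 X|) ≤ vol * ((EwA + EwB) * a ^ (K - j)) := by
  intro j hj
  rw [sum_add_distrib]
  have h := add_le_add (hA j hj) (hB j hj)
  linarith [h]

/-- [bookkeeping] Monotonicity of `QLa` in the size constant and the ratio (`0 ≤ vol`, `0 ≤ Ew`, `0 ≤ a ≤ a'`): a producer may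
deliver any smaller constants. [folklore] -/
theorem QLa.mono {wf : Finset D} {sc : D → ℕ} {ct c0 : D → ℝ} {K : ℕ} {vol Ew Ew' a a' : ℝ}
    (h : QLa wf sc ct c0 K vol Ew a) (hvol : 0 ≤ vol) (hEw : 0 ≤ Ew) (hEw' : Ew ≤ Ew') (ha : 0 ≤ a) (ha' : a ≤ a') :
    QLa wf sc ct c0 K vol Ew' a' := fun j hj =>
  (h j hj).trans <| mul_le_mul_of_nonneg_left
    (mul_le_mul hEw' (pow_le_pow_left₀ ha ha' _) (pow_nonneg ha _) (hEw.trans hEw')) hvol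

/-- [bookkeeping] The undressed case: a run whose step constants do not see the source (`ct = c0`) satisfies `QLa` with
`Ew = 0` — the shape asks nothing of `t`-blind terms (route 1's (W-loc): only the near-support sub-ledger carries `t`).
[folklore] -/
theorem qla_of_blind {wf : Finset D} {sc : D → ℕ} {ct c0 : D → ℝ} {K : ℕ} {vol a : ℝ} (h : ∀ X ∈ wf, ct X = c0 X) :
    QLa wf sc ct c0 K vol 0 a := fun j _ => by
  rw [sum_eq_zero fun X hX => by rw [h X (mem_filter.mp hX).1, sub_self, abs_zero]]
  simp

/-- SANITY (the shape is the consumer's binder, by `rfl` on one run doubled): with `cB = cA` the two-run slice is twice the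
one-run slice. [folklore] -/
example {wf : Finset D} {sc : D → ℕ} {ct c0 : D → ℝ} {K : ℕ} {vol Ew a : ℝ} (h : QLa wf sc ct c0 K vol Ew a) :
    ∀ j ≤ K, ∑ X ∈ wf with sc X = j, (|ct X - c0 X| + |ct X - c0 X|) ≤ vol * ((Ew + Ew) * a ^ (K - j)) :=
  hsize_of_qla h h

end Summit.QuantumFields.BalabanUV.T4Continuum.Spine.NE7

end
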